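import Summits.BirchSwinnertonDyer.BirchSwinnertonDyer.Theorems.PrintX10bStubAExactRepAtP
import Summits.BirchSwinnertonDyer.BirchSwinnertonDyer.Theorems.UniversalToricDescentTwinH4AtSAnnSat
import Literature.NumberTheory.EllipticCurves.ZpExtensionEisensteinDVRSettingH4OrdinaryIsotropyMultiplicativeThreeProofs
import HarnessLib

/-!
# (Exact) at the places `v ∣ 3` for a curve with MULTIPLICATIVE reduction at `3` — the twin frame of crux 24737
# (helper, THEOREMS ONLY: no definition, no named fact, no instance, no `sorry`)

Helper toward the registered stub `stub_howardOutputsOfFamily` (K2) of line `beta-road` (skeleton v10 cd44fe9d5c6b9a78) of crux r205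
stmt-BirchSwinnertonDyer-24737 `…Theses.UniversalToricDescent.TwinAlgMuZeroAtThree` (LEAD lineage `bsd-wall-utd-p1`, g25): the second
SUMMITS-side brick of the twin's E2 (H-twin) assembly.  x10b's letter `HeegnerMuPartH4AtS.Stmt.exactAtP`
(`Theorems/PrintX10bStubAH4AtSOfExactAtP`: the two (Exact) hypotheses `hExactY`/`hExactX` of `eisensteinTower_isSelfOrthogonalAt_of_mem`
for the `D`-indexed local Eisenstein towers at `v ∣ p`, on the `Thm413Hypotheses` frames) restated at `p = 3` on the TWIN frame (`K`
imaginary quadratic, `κ` anticyclotomic, `K` Heegner for `N`, multiplicative reduction of `W_K` above `3`) and PROVED: (EXACT-REP) is x9's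
reduction-type-free `eisensteinTower_exists_sub_pow_smul_forall_localCup{,_flip}_eq_zero` (Poitou–Tate discharged by
`HeegnerMuPartH4AtS.poitouTate_holds`), (ANN-SAT) is `UniversalToricDescentTwinH4AtSAnnSat.annSatAtThree_of_hasMultiplicativeReductionAt`
(p760914), and the composition is x10b's three lines of tower algebra (`exactAtP_of_exactRep_of_annSat`).  Next (g26): H.4 at every
`v ∈ S` from this (x10b's `h4AtS_of_exactAtP'`, whose `v ∣ p` inputs are twinned: p759280; the `v ∤ p` inputs are x9-generic).
Bookkeeping toward one stub of one crux; no summit statement is proved; BSD is not proved by any of this.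
-/

set_option linter.dupNamespace false
set_option autoImplicit false

noncomputable section

open scoped Classical Pointwise ContRepresentation TensorProduct NumberField

open Function NumberField IsDedekindDomain Field
open Literature Literature.NumberTheory.EllipticCurves WeierstrassCurve
open Literature.NumberTheory.GaloisCohomology Literature.NumberTheory.GaloisCohomology.Howard2004
open Literature.NumberTheory.GaloisRepresentations Literature.NumberTheory.GaloisRepresentations.DiscreteGaloisModule
open Literature.NumberTheory.Automorphic
open Literature.NumberTheory.EllipticCurves.ZpExtension (EisensteinLevel)
open Summit.BirchSwinnertonDyer.BirchSwinnertonDyer.Theorems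


namespace Summit.BirchSwinnertonDyer.BirchSwinnertonDyer.Theorems.UniversalToricDescentTwinH4AtSExactAtThree

set_option synthInstance.maxHeartbeats 80000 in
set_option maxHeartbeats 1600000 in
/-- **(Exact) at `v ∣ 3` on the twin frame** (multiplicative reduction above `3`, `K` imaginary quadratic Heegner for `N`, `κ`
anticyclotomic): for all `m ≥ m₅(S)`, at every `(k, v ∈ S, 3 ∈ v)`, (Y) every compatible family `η` of `(H¹(K_v, Tw T^{(j)}))_j`
orthogonal at level `k` to the saturated strict-ordinary families at `v` is `3^{k+1} η′ +` a family saturated for the transported cores,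
and (X) the flipped twin — x10b's `Stmt.exactAtP` body at `p = 3` on the twin frame.
[cite: Howard2004HeegnerKolyvagin, §1.3 H.4, Lemma 3.1.1 and Def. 3.2.6 (arXiv p. 7 L78–82, p. 15–16)]
[cite: MilneADT2006, Ch. I Cor. 2.3 and Thm. 2.6] -/
theorem exactAtThree_of_hasMultiplicativeReductionAt :
  ∀ (N : ℕ) [NeZero N] (W : WeierstrassCurve ℚ) [W.IsElliptic] (K : Type) [Field K] [NumberField K]
    (κ : ZpExtension K 3),
    IsImaginaryQuadratic K → κ.IsAnticyclotomic → SatisfiesHeegnerHypothesis N K →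
    (∀ w : HeightOneSpectrum (𝓞 K), ((3 : ℕ) : 𝓞 K) ∈ w.asIdeal → (W.baseChange K).HasMultiplicativeReductionAt w) →
    ∀ (S : Finset (HeightOneSpectrum (𝓞 K)))
      (hpS : ∀ v, ((3 : ℕ) : 𝓞 K) ∈ v.asIdeal → v ∈ S)
      (hbad : ∀ v, v ∉ S → ((3 : ℕ) : 𝓞 K) ∉ v.asIdeal → (W.baseChange K).HasGoodReductionAt v),
    (∀ v ∈ S, ((3 : ℕ) : 𝓞 K) ∈ v.asIdeal ∨ ((N : ℕ) : 𝓞 K) ∈ v.asIdeal) →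
    (∀ (σ : K ≃ₐ[ℚ] K) (v : HeightOneSpectrum (𝓞 K)), σ • v ∈ S → v ∈ S) →
    ∃ m₆ : ℕ, ∀ (m : ℕ) (hm : 1 ≤ m), m₆ ≤ m →
      letI := IwasawaAlgebra.isDomain_quotient_X_pow_add_C 3 hm
      letI := IwasawaAlgebra.isDiscreteValuationRing_quotient_X_pow_add_C 3 hm
      haveI := IwasawaAlgebra.EisensteinCoeff.isLocalRing_succ 3 hm
      letI := IwasawaAlgebra.EisensteinCoeff.algebraOfSpecSucc 3 m
      haveI := W.isScalarTower_algebraOfSpecSucc (K := K) (p := 3) (m := m)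
      letI := W.residueModuleSucc (K := K) (p := 3) hm
      ∀ (L : Set (HeightOneSpectrum (𝓞 K)))
        (hL : L ⊆ (W.eisensteinTower (κ.unitTwist (-1)) hm).degreeTwoPrimes 3) (hLS : ∀ v ∈ L, v ∉ S)
        (c₀ : absoluteGaloisGroup ℚ) (σ : K ≃ₐ[ℚ] K) (hσ₁ : σ ≠ 1) (hσ : σ * σ = 1)
        (hτl : IsLiftOfAut σ (absGaloisTransport (K := ℚ) (L := K) c₀).toRingEquiv)
        (hτ₂ : Function.Involutive (absGaloisTransport (K := ℚ) (L := K) c₀).toRingEquiv)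
        (D : ∀ k, DualityDatum 3 (ConjugationDatum.ofLifts σ hσ₁ hσ _ hτl hτ₂)
          ((W.eisensteinTower (κ.unitTwist (-1)) hm).ρ k) (IwasawaAlgebra.EisensteinCoeff 3 m (k + 1)))
        (e : ∀ j : ℕ, geomTorsion (W.baseChange K) (((3 : ℕ) : ℤ) ^ j) →+ geomTorsion (W.baseChange K) (((3 : ℕ) : ℤ) ^ j) →+
          MuCarrier K (3 ^ j))
        (log : ∀ j : ℕ, MuCarrier K (3 ^ j) →+ ZMod (3 ^ j)),
        IsComplexConjugation (Rat.castHom ℝ) c₀ →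
        (∀ x, (ConjugationDatum.ofLifts σ hσ₁ hσ _ hτl hτ₂).τ x = absGaloisTransport (K := ℚ) (L := K) c₀ x) →
        (∀ k, (D k).e = ZpExtension.eisensteinDualityForm hm (k + 1)
          (conjPairing (e (k + 1)) ((ConjugationDatum.ofLifts σ hσ₁ hσ _ hτl hτ₂).isLift.torsionMap W _)
            (log (k + 1)))) →
        (∀ k (x y : EisensteinLevel 3 m (fun j ↦ geomTorsion (W.baseChange K) (((3 : ℕ) : ℤ) ^ j)) (k + 1 + 1)),
          IwasawaAlgebra.EisensteinCoeff.reduce 3 m (Nat.le_succ (k + 1)) ((D (k + 1)).e x y) =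
            (D k).e ((W.eisensteinTower (κ.unitTwist (-1)) hm).red k x) ((W.eisensteinTower (κ.unitTwist (-1)) hm).red k y)) →
        (∀ j a, e j a a = 0) →
        (∀ j (g : absoluteGaloisGroup K) a b, e j (g • a) (g • b) = mu K (3 ^ j) g (e j a b)) →
        (∀ j a b, e j ((ConjugationDatum.ofLifts σ hσ₁ hσ _ hτl hτ₂).isLift.torsionMap W _ a)
          ((ConjugationDatum.ofLifts σ hσ₁ hσ _ hτl hτ₂).isLift.torsionMap W _ b) = -e j a b) →
        (∀ j (a : geomTorsion (W.baseChange K) (((3 : ℕ) : ℤ) ^ j)),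
          (ConjugationDatum.ofLifts σ hσ₁ hσ _ hτl hτ₂).isLift.torsionMap W _
            ((ConjugationDatum.ofLifts σ hσ₁ hσ _ hτl hτ₂).isLift.torsionMap W _ a) = a) →
        (∀ j, Function.Bijective (log j)) →
        (∀ j (g : absoluteGaloisGroup K) ξ, log j (mu K (3 ^ j) g ξ) = cyclotomicCharacterModPow K 3 j g * log j ξ) →
        ∀ (k : ℕ) (v : HeightOneSpectrum (𝓞 K)), v ∈ S → ((3 : ℕ) : 𝓞 K) ∈ v.asIdeal →
          (∀ η ∈ Tower.compatibleFamilies (H := fun j ↦ galoisCohomology (((ConjugationDatum.ofLifts σ hσ₁ hσ _ hτl hτ₂).twist ((W.eisensteinTower (κ.unitTwist (-1)) hm).ρ j)).toLocal (Sum.inr v)) 1)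
              (fun j ↦ ContinuousRep.cohomologyMap (((ConjugationDatum.ofLifts σ hσ₁ hσ _ hτl hτ₂).twist ((W.eisensteinTower (κ.unitTwist (-1)) hm).ρ (j + 1))).toLocal (Sum.inr v))
            (((ConjugationDatum.ofLifts σ hσ₁ hσ _ hτl hτ₂).twist ((W.eisensteinTower (κ.unitTwist (-1)) hm).ρ j)).toLocal (Sum.inr v)) ((W.eisensteinTower (κ.unitTwist (-1)) hm).red j).toAddMonoidHom
            continuous_of_discreteTopology (fun _ z => (W.eisensteinTower (κ.unitTwist (-1)) hm).red_equivariant j _ z) 1),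
            (∀ ξ ∈ Tower.saturatedFamilies (H := fun j ↦ galoisCohomology (((W.eisensteinTower (κ.unitTwist (-1)) hm).ρ j).toLocal (Sum.inr v)) 1)
                (fun j ↦ ContinuousRep.cohomologyMap (((W.eisensteinTower (κ.unitTwist (-1)) hm).ρ (j + 1)).toLocal (Sum.inr v))
            (((W.eisensteinTower (κ.unitTwist (-1)) hm).ρ j).toLocal (Sum.inr v)) ((W.eisensteinTower (κ.unitTwist (-1)) hm).red j).toAddMonoidHom
            continuous_of_discreteTopology (fun _ z => (W.eisensteinTower (κ.unitTwist (-1)) hm).red_equivariant j _ z) 1) 3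
                (fun j ↦ ((W.baseChange K).ordinaryFiltrationAt v (fun j ↦ (W.baseChange K).torsionGaloisModuleReduce 3 j) (fun _ _ ↦ rfl)).ordinaryCore hm (j + 1)),
              (D k).localCup (Sum.inr v) (ξ k) (η k) = 0) →
            ∃ η' : Π j, galoisCohomology (((ConjugationDatum.ofLifts σ hσ₁ hσ _ hτl hτ₂).twist ((W.eisensteinTower (κ.unitTwist (-1)) hm).ρ j)).toLocal (Sum.inr v)) 1,
              η - 3 ^ (k + 1) • η' ∈ Tower.saturatedFamilies (H := fun j ↦ galoisCohomology (((ConjugationDatum.ofLifts σ hσ₁ hσ _ hτl hτ₂).twist ((W.eisensteinTower (κ.unitTwist (-1)) hm).ρ j)).toLocal (Sum.inr v)) 1)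
                (fun j ↦ ContinuousRep.cohomologyMap (((ConjugationDatum.ofLifts σ hσ₁ hσ _ hτl hτ₂).twist ((W.eisensteinTower (κ.unitTwist (-1)) hm).ρ (j + 1))).toLocal (Sum.inr v))
            (((ConjugationDatum.ofLifts σ hσ₁ hσ _ hτl hτ₂).twist ((W.eisensteinTower (κ.unitTwist (-1)) hm).ρ j)).toLocal (Sum.inr v)) ((W.eisensteinTower (κ.unitTwist (-1)) hm).red j).toAddMonoidHom
            continuous_of_discreteTopology (fun _ z => (W.eisensteinTower (κ.unitTwist (-1)) hm).red_equivariant j _ z) 1) 3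
                (fun j ↦ (((W.baseChange K).ordinaryFiltrationAt ((ConjugationDatum.ofLifts σ hσ₁ hσ _ hτl hτ₂).σ • v) (fun j ↦ (W.baseChange K).torsionGaloisModuleReduce 3 j) (fun _ _ ↦ rfl)).ordinaryCore hm (j + 1)).map
            ((ConjugationDatum.ofLifts σ hσ₁ hσ _ hτl hτ₂).transportH1 ((κ.unitTwist (-1)).eisensteinTwist ((W.baseChange K).torsionGaloisModule (((3 : ℕ) : ℤ) ^ (j + 1))) hm (j + 1)) v))) ∧
          (∀ ξ ∈ Tower.compatibleFamilies (H := fun j ↦ galoisCohomology (((W.eisensteinTower (κ.unitTwist (-1)) hm).ρ j).toLocal (Sum.inr v)) 1)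
              (fun j ↦ ContinuousRep.cohomologyMap (((W.eisensteinTower (κ.unitTwist (-1)) hm).ρ (j + 1)).toLocal (Sum.inr v))
            (((W.eisensteinTower (κ.unitTwist (-1)) hm).ρ j).toLocal (Sum.inr v)) ((W.eisensteinTower (κ.unitTwist (-1)) hm).red j).toAddMonoidHom
            continuous_of_discreteTopology (fun _ z => (W.eisensteinTower (κ.unitTwist (-1)) hm).red_equivariant j _ z) 1),
            (∀ η ∈ Tower.saturatedFamilies (H := fun j ↦ galoisCohomology (((ConjugationDatum.ofLifts σ hσ₁ hσ _ hτl hτ₂).twist ((W.eisensteinTower (κ.unitTwist (-1)) hm).ρ j)).toLocal (Sum.inr v)) 1)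
                (fun j ↦ ContinuousRep.cohomologyMap (((ConjugationDatum.ofLifts σ hσ₁ hσ _ hτl hτ₂).twist ((W.eisensteinTower (κ.unitTwist (-1)) hm).ρ (j + 1))).toLocal (Sum.inr v))
            (((ConjugationDatum.ofLifts σ hσ₁ hσ _ hτl hτ₂).twist ((W.eisensteinTower (κ.unitTwist (-1)) hm).ρ j)).toLocal (Sum.inr v)) ((W.eisensteinTower (κ.unitTwist (-1)) hm).red j).toAddMonoidHom
            continuous_of_discreteTopology (fun _ z => (W.eisensteinTower (κ.unitTwist (-1)) hm).red_equivariant j _ z) 1) 3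
                (fun j ↦ (((W.baseChange K).ordinaryFiltrationAt ((ConjugationDatum.ofLifts σ hσ₁ hσ _ hτl hτ₂).σ • v) (fun j ↦ (W.baseChange K).torsionGaloisModuleReduce 3 j) (fun _ _ ↦ rfl)).ordinaryCore hm (j + 1)).map
            ((ConjugationDatum.ofLifts σ hσ₁ hσ _ hτl hτ₂).transportH1 ((κ.unitTwist (-1)).eisensteinTwist ((W.baseChange K).torsionGaloisModule (((3 : ℕ) : ℤ) ^ (j + 1))) hm (j + 1)) v)),
              (D k).localCup (Sum.inr v) (ξ k) (η k) = 0) →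
            ∃ ξ' : Π j, galoisCohomology (((W.eisensteinTower (κ.unitTwist (-1)) hm).ρ j).toLocal (Sum.inr v)) 1,
              ξ - 3 ^ (k + 1) • ξ' ∈ Tower.saturatedFamilies (H := fun j ↦ galoisCohomology (((W.eisensteinTower (κ.unitTwist (-1)) hm).ρ j).toLocal (Sum.inr v)) 1)
                (fun j ↦ ContinuousRep.cohomologyMap (((W.eisensteinTower (κ.unitTwist (-1)) hm).ρ (j + 1)).toLocal (Sum.inr v))
            (((W.eisensteinTower (κ.unitTwist (-1)) hm).ρ j).toLocal (Sum.inr v)) ((W.eisensteinTower (κ.unitTwist (-1)) hm).red j).toAddMonoidHom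
            continuous_of_discreteTopology (fun _ z => (W.eisensteinTower (κ.unitTwist (-1)) hm).red_equivariant j _ z) 1) 3
                (fun j ↦ ((W.baseChange K).ordinaryFiltrationAt v (fun j ↦ (W.baseChange K).torsionGaloisModuleReduce 3 j) (fun _ _ ↦ rfl)).ordinaryCore hm (j + 1))) := by
  intro N _ W _ K _ _ κ hK hanti₀ hHeeg hmultw S hpS hbad hSN hSσ
  obtain ⟨m₅, h5⟩ := UniversalToricDescentTwinH4AtSAnnSat.annSatAtThree_of_hasMultiplicativeReductionAt N W K κ hK hanti₀ hHeeg
    hmultw S hpS hbad hSN hSσ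
  refine ⟨m₅, fun m hm hle L hL hLS c₀ σ hσ₁ hσ hτl hτ₂ D e log hc₀ hτ hDe he_red h4' h5' h6' h7' h8' h9' k v hvS hpv ↦ ?_⟩
  letI := IwasawaAlgebra.isDomain_quotient_X_pow_add_C 3 hm
  letI := IwasawaAlgebra.isDiscreteValuationRing_quotient_X_pow_add_C 3 hm
  haveI := IwasawaAlgebra.EisensteinCoeff.isLocalRing_succ 3 hm
  letI := IwasawaAlgebra.EisensteinCoeff.algebraOfSpecSucc 3 m
  haveI := W.isScalarTower_algebraOfSpecSucc (K := K) (p := 3) (m := m)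
  letI := W.residueModuleSucc (K := K) (p := 3) hm
  have hPT : poitouTate_selmerStructure_duality K := HeegnerMuPartH4AtS.poitouTate_holds K
  obtain ⟨hAY, hAX⟩ := h5 m hm hle L hL hLS c₀ σ hσ₁ hσ hτl hτ₂ D e log hc₀ hτ hDe he_red h4' h5' h6' h7' h8' h9' v hvS hpv
  -- (EXACT-REP), both orientations: generic, reduction-type free (x9-p1-w2/w4; Poitou–Tate discharged)
  refine ⟨fun η hη hη0 ↦ ?_, fun ξ hξ hξ0 ↦ ?_⟩
  · obtain ⟨y, hy, hy0⟩ := W.eisensteinTower_exists_sub_pow_smul_forall_localCup_eq_zero (κ.unitTwist (-1)) hm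
      (ConjugationDatum.ofLifts σ hσ₁ hσ _ hτl hτ₂) D he_red hPT v
      (fun j ↦ ((W.baseChange K).ordinaryFiltrationAt v (fun j ↦ (W.baseChange K).torsionGaloisModuleReduce 3 j)
        (fun _ _ ↦ rfl)).ordinaryCore hm (j + 1))
      (fun j c x hx ↦ ((W.baseChange K).ordinaryFiltrationAt v (fun j ↦ (W.baseChange K).torsionGaloisModuleReduce 3 j)
        (fun _ _ ↦ rfl)).scalarMapH1_mem_ordinaryCore hm (j + 1) c hx) k hη hη0
    exact ⟨y, hAY _ (sub_mem hη (AddSubgroup.nsmul_mem _ hy _)) fun j ξ hξ ↦ by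
      simpa only [Pi.sub_apply, Pi.smul_apply] using hy0 j ξ hξ⟩
  · obtain ⟨x, hx, hx0⟩ := W.eisensteinTower_exists_sub_pow_smul_forall_localCup_flip_eq_zero (κ.unitTwist (-1)) hm
      (ConjugationDatum.ofLifts σ hσ₁ hσ _ hτl hτ₂) D he_red hPT v
      (fun j ↦ (((W.baseChange K).ordinaryFiltrationAt ((ConjugationDatum.ofLifts σ hσ₁ hσ _ hτl hτ₂).σ • v)
        (fun j ↦ (W.baseChange K).torsionGaloisModuleReduce 3 j) (fun _ _ ↦ rfl)).ordinaryCore hm (j + 1)).map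
        ((ConjugationDatum.ofLifts σ hσ₁ hσ _ hτl hτ₂).transportH1
          ((κ.unitTwist (-1)).eisensteinTwist ((W.baseChange K).torsionGaloisModule (((3 : ℕ) : ℤ) ^ (j + 1))) hm (j + 1)) v))
      (fun j c y hy ↦ W.scalarMapH1_mem_map_transportH1_ordinaryCore (κ.unitTwist (-1)) hm
        (ConjugationDatum.ofLifts σ hσ₁ hσ _ hτl hτ₂) v
        ((W.baseChange K).ordinaryFiltrationAt ((ConjugationDatum.ofLifts σ hσ₁ hσ _ hτl hτ₂).σ • v)
          (fun j ↦ (W.baseChange K).torsionGaloisModuleReduce 3 j) (fun _ _ ↦ rfl)) j c y hy) k hξ hξ0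
    exact ⟨x, hAX _ (sub_mem hξ (AddSubgroup.nsmul_mem _ hx _)) fun j η hη ↦ by
      simpa only [Pi.sub_apply, Pi.smul_apply] using hx0 j η hη⟩

set_option synthInstance.maxHeartbeats 80000 in
set_option maxHeartbeats 1600000 in
/-- **H.4 at every place of `S` on the twin frame** — x10b's letter `Stmt.h4AtS` at `p = 3` for a curve with MULTIPLICATIVE reduction above
`3` (`K` imaginary quadratic Heegner for `N`, `κ` anticyclotomic): for all `m ≥ m₆(S)`, every `k` and every `v ∈ S`, the instantiated H.4 data
`D k` are self-orthogonal at `v` for the propagated Selmer structure of the Eisenstein tower triple — the `hfin4` clause of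
`UniversalToricDescentTwinHowardSettingSatisfiesH.exists_eisensteinSettingData_satisfiesH_eRed_of_hasSurjectiveModNGaloisRep` for the twin.
Proof = x10b's `h4AtS_of_exactAtP` (Poitou–Tate discharged): at `v ∣ 3` (Exact) (`exactAtThree_of_hasMultiplicativeReductionAt`) + module
isotropy (`eisensteinTower_orthogonal_twistedFil_of_e_eq_of_hasMultiplicativeReductionAt_three`, p759280) through
`eisensteinTower_isSelfOrthogonalAt_of_mem`; at `v ∤ 3` the torsion descent with the uniform (N1) bounds (curve-generic).
[cite: Howard2004HeegnerKolyvagin, §1.3 H.4, Lemma 3.1.1 and Def. 3.2.6 (arXiv p. 7 L78–82, p. 15–16)] [cite: MilneADT2006, Ch. I Cor. 2.3 and Thm. 2.6] -/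
theorem h4AtThree_of_hasMultiplicativeReductionAt :
  ∀ (N : ℕ) [NeZero N] (W : WeierstrassCurve ℚ) [W.IsElliptic] (K : Type) [Field K] [NumberField K]
    (κ : ZpExtension K 3),
    IsImaginaryQuadratic K → κ.IsAnticyclotomic → SatisfiesHeegnerHypothesis N K →
    (∀ w : HeightOneSpectrum (𝓞 K), ((3 : ℕ) : 𝓞 K) ∈ w.asIdeal → (W.baseChange K).HasMultiplicativeReductionAt w) →
    ∀ (S : Finset (HeightOneSpectrum (𝓞 K)))
      (hpS : ∀ v, ((3 : ℕ) : 𝓞 K) ∈ v.asIdeal → v ∈ S)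
      (hbad : ∀ v, v ∉ S → ((3 : ℕ) : 𝓞 K) ∉ v.asIdeal → (W.baseChange K).HasGoodReductionAt v),
    (∀ v ∈ S, ((3 : ℕ) : 𝓞 K) ∈ v.asIdeal ∨ ((N : ℕ) : 𝓞 K) ∈ v.asIdeal) →
    (∀ (σ : K ≃ₐ[ℚ] K) (v : HeightOneSpectrum (𝓞 K)), σ • v ∈ S → v ∈ S) →
    ∃ m₄ : ℕ, ∀ (m : ℕ) (hm : 1 ≤ m), m₄ ≤ m →
      letI := IwasawaAlgebra.isDomain_quotient_X_pow_add_C 3 hm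
      letI := IwasawaAlgebra.isDiscreteValuationRing_quotient_X_pow_add_C 3 hm
      haveI := IwasawaAlgebra.EisensteinCoeff.isLocalRing_succ 3 hm
      letI := IwasawaAlgebra.EisensteinCoeff.algebraOfSpecSucc 3 m
      haveI := W.isScalarTower_algebraOfSpecSucc (K := K) (p := 3) (m := m)
      letI := W.residueModuleSucc (K := K) (p := 3) hm
      ∀ (L : Set (HeightOneSpectrum (𝓞 K)))
        (hL : L ⊆ (W.eisensteinTower (κ.unitTwist (-1)) hm).degreeTwoPrimes 3) (hLS : ∀ v ∈ L, v ∉ S)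
        (c₀ : absoluteGaloisGroup ℚ) (σ : K ≃ₐ[ℚ] K) (hσ₁ : σ ≠ 1) (hσ : σ * σ = 1)
        (hτl : IsLiftOfAut σ (absGaloisTransport (K := ℚ) (L := K) c₀).toRingEquiv)
        (hτ₂ : Function.Involutive (absGaloisTransport (K := ℚ) (L := K) c₀).toRingEquiv)
        (D : ∀ k, DualityDatum 3 (ConjugationDatum.ofLifts σ hσ₁ hσ _ hτl hτ₂)
          ((W.eisensteinTower (κ.unitTwist (-1)) hm).ρ k) (IwasawaAlgebra.EisensteinCoeff 3 m (k + 1)))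
        (e : ∀ j : ℕ, geomTorsion (W.baseChange K) (((3 : ℕ) : ℤ) ^ j) →+ geomTorsion (W.baseChange K) (((3 : ℕ) : ℤ) ^ j) →+
          MuCarrier K (3 ^ j))
        (log : ∀ j : ℕ, MuCarrier K (3 ^ j) →+ ZMod (3 ^ j)),
        IsComplexConjugation (Rat.castHom ℝ) c₀ →
        (∀ x, (ConjugationDatum.ofLifts σ hσ₁ hσ _ hτl hτ₂).τ x = absGaloisTransport (K := ℚ) (L := K) c₀ x) →
        (∀ k, (D k).e = ZpExtension.eisensteinDualityForm hm (k + 1)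
          (conjPairing (e (k + 1)) ((ConjugationDatum.ofLifts σ hσ₁ hσ _ hτl hτ₂).isLift.torsionMap W _)
            (log (k + 1)))) →
        (∀ k (x y : EisensteinLevel 3 m (fun j ↦ geomTorsion (W.baseChange K) (((3 : ℕ) : ℤ) ^ j)) (k + 1 + 1)),
          IwasawaAlgebra.EisensteinCoeff.reduce 3 m (Nat.le_succ (k + 1)) ((D (k + 1)).e x y) =
            (D k).e ((W.eisensteinTower (κ.unitTwist (-1)) hm).red k x) ((W.eisensteinTower (κ.unitTwist (-1)) hm).red k y)) →
        (∀ j a, e j a a = 0) →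
        (∀ j (g : absoluteGaloisGroup K) a b, e j (g • a) (g • b) = mu K (3 ^ j) g (e j a b)) →
        (∀ j a b, e j ((ConjugationDatum.ofLifts σ hσ₁ hσ _ hτl hτ₂).isLift.torsionMap W _ a)
          ((ConjugationDatum.ofLifts σ hσ₁ hσ _ hτl hτ₂).isLift.torsionMap W _ b) = -e j a b) →
        (∀ j (a : geomTorsion (W.baseChange K) (((3 : ℕ) : ℤ) ^ j)),
          (ConjugationDatum.ofLifts σ hσ₁ hσ _ hτl hτ₂).isLift.torsionMap W _
            ((ConjugationDatum.ofLifts σ hσ₁ hσ _ hτl hτ₂).isLift.torsionMap W _ a) = a) →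
        (∀ j, Function.Bijective (log j)) →
        (∀ j (g : absoluteGaloisGroup K) ξ, log j (mu K (3 ^ j) g ξ) = cyclotomicCharacterModPow K 3 j g * log j ξ) →
        ∀ k, ∀ v ∈ S, (D k).IsSelfOrthogonalAt
          (W.eisensteinTowerTriple (κ.unitTwist (-1)) hm S hpS hbad L hL hLS k).cond v := by
  intro N _ W _ K _ _ κ hK hanti₀ hHeeg hmultw S hpS hbad hSN hSσ
  classical
  have hanti : (κ.unitTwist (-1)).IsAnticyclotomic := hanti₀.unitTwist (-1)
  have hN0 : N ≠ 0 := NeZero.ne N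
  have hdec : ∀ v ∈ S, ((3 : ℕ) : 𝓞 K) ∉ v.asIdeal → ¬ (GreenbergSelmer.decomp v ≤ (κ.unitTwist (-1)).kerSubgroup) :=
    fun v hv _ ↦ ZpExtension.decomp_not_le_kerSubgroup_of_mem_or_mem hK (κ.unitTwist (-1)) hanti hHeeg hN0 hSN v hv
  -- the (N1) bounds at the places of `S` prime to `p` (dummy elsewhere)
  have hvN : ∀ v ∈ S, ((3 : ℕ) : 𝓞 K) ∉ v.asIdeal →
      ∃ Nv : ℕ, 1 ≤ Nv ∧ ∀ (m : ℕ) (hm : 1 ≤ m), 2 * Nv < m → ∀ (j : ℕ)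
        (x : galoisCohomology (GaloisRep.toLocal v
          ((κ.unitTwist (-1)).eisensteinTwist ((W.baseChange K).torsionGaloisModule (((3 : ℕ) : ℤ) ^ j)) hm j)) 1), 3 ^ (8 * Nv) • x = 0 :=
    fun v hvS hpv ↦ exists_forall_pow_smul_galoisCohomology_one_toLocal_eq_zero_uniform v (W.baseChange K) (κ.unitTwist (-1)) hpv
      (hdec v hvS hpv)
  choose! Nv hNv using hvN
  obtain ⟨m₆, h6⟩ := exactAtThree_of_hasMultiplicativeReductionAt N W K κ hK hanti₀ hHeeg hmultw S hpS hbad hSN hSσ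
  refine ⟨max (S.sup (fun v ↦ 2 * Nv v) + 1) m₆, fun m hm hle L hL hLS c₀ σ hσ₁ hσ hτl hτ₂ D e log hc₀ hτ hDe he_red
    h4' h5' h6' h7' h8' h9' k v hvS ↦ ?_⟩
  have hm6 : m₆ ≤ m := le_trans (le_max_right _ _) hle
  have hsup : S.sup (fun v ↦ 2 * Nv v) < m :=
    Nat.lt_of_lt_of_le (Nat.lt_succ_self _) (le_trans (le_max_left _ _) hle)
  letI := IwasawaAlgebra.isDomain_quotient_X_pow_add_C 3 hm
  letI := IwasawaAlgebra.isDiscreteValuationRing_quotient_X_pow_add_C 3 hm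
  haveI := IwasawaAlgebra.EisensteinCoeff.isLocalRing_succ 3 hm
  letI := IwasawaAlgebra.EisensteinCoeff.algebraOfSpecSucc 3 m
  haveI := W.isScalarTower_algebraOfSpecSucc (K := K) (p := 3) (m := m)
  letI := W.residueModuleSucc (K := K) (p := 3) hm
  by_cases hpv : ((3 : ℕ) : 𝓞 K) ∈ v.asIdeal
  · -- `v ∣ p`: (Exact) + module isotropy
    have hσpv : ((3 : ℕ) : 𝓞 K) ∈ ((ConjugationDatum.ofLifts σ hσ₁ hσ _ hτl hτ₂).σ • v).asIdeal :=
      (WeierstrassCurve.natCast_mem_smul_asIdeal_iff (K := K) (p := 3) σ v).2 hpv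
    obtain ⟨hEY, hEX⟩ := h6 m hm hm6 L hL hLS c₀ σ hσ₁ hσ hτl hτ₂ D e log hc₀ hτ hDe he_red h4' h5' h6' h7' h8' h9' k v hvS hpv
    exact W.eisensteinTower_isSelfOrthogonalAt_of_mem (κ.unitTwist (-1)) hm S hpS hbad L hL hLS (ConjugationDatum.ofLifts σ hσ₁ hσ _ hτl hτ₂) D he_red (HeegnerMuPartH4AtS.poitouTate_holds K) k hpv hσpv
      (W.eisensteinTower_orthogonal_twistedFil_of_e_eq_of_hasMultiplicativeReductionAt_three (κ.unitTwist (-1)) hm σ hσ₁ hσ _ hτl hτ₂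
        D e log hDe h4' h8' h7' hpv (hmultw v hpv))
      hEY hEX
  · -- `v ∤ p`: the torsion descent with the (N1) bounds at `v` and `σ•v`
    have hσvS : σ • v ∈ S := hSσ σ _ (by rwa [smul_smul, hσ, one_smul])
    have hσpv : ((3 : ℕ) : 𝓞 K) ∉ (σ • v).asIdeal := fun h ↦
      hpv ((WeierstrassCurve.natCast_mem_smul_asIdeal_iff (K := K) (p := 3) σ v).1 h)
    have h2v : 2 * Nv v < m := lt_of_le_of_lt (Finset.le_sup (f := fun v ↦ 2 * Nv v) hvS) hsup
    have h2σv : 2 * Nv (σ • v) < m := lt_of_le_of_lt (Finset.le_sup (f := fun v ↦ 2 * Nv v) hσvS) hsup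
    exact W.eisensteinTower_isSelfOrthogonalAt_of_mem_of_not_mem_ofLifts (κ.unitTwist (-1)) hm S hpS hbad L hL hLS σ hσ₁ hσ _ hτl hτ₂ D
      he_red (HeegnerMuPartH4AtS.poitouTate_holds K) k hpv hvS hσpv hσvS
      (fun j x ↦ (hNv v hvS hpv).2 m hm h2v (j + 1) x) (fun j x ↦ (hNv (σ • v) hσvS hσpv).2 m hm h2σv (j + 1) x)

end Summit.BirchSwinnertonDyer.BirchSwinnertonDyer.Theorems.UniversalToricDescentTwinH4AtSExactAtThree

end
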